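import Mathlib
import Summits.Schanuel.Schanuel.Theorems.DiophantineDichotomyDefs
import Literature.NumberTheory.Transcendental.RoyCriterion

/-!
# Sketch (crux-ideate r1, ideator 3 gen 2) — crux `KhovanskiiApproxType` (stmt-Schanuel-6116)

Vocabulary and first lemmas for the idea cards

* `graph-uniform-lw`  (moving-frequency transfer: the crux at every free Khovanskii point from ONE
  θ-free simultaneous Hermite–Lindemann measure on the graph of `exp` — `GraphMeasure` — plus a
  polynomial linear-independence measure of `s` — `PolyLinIndep` — for the ℚ-degenerate challengers);
* `roy-transport` (Roy's auxiliary polynomials transported from `(s, e^s)` to the challenger's own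
  subgroup of `K × Kˣ`; the crux from a degree-effective small-value prohibition at ALGEBRAIC
  configurations — `AlgSmallValueProhibition`).

Imports the line's definitions module (`IsFreeKhovanskii`, `ApproxTypeAt`, `khovanskiiApproxType_iff`).
-/

noncomputable section

set_option linter.dupNamespace false

open scoped BigOperators

namespace Summit.Schanuel.Schanuel.Cruxes.KhovanskiiApproxType.Ideate3g2

open Summit.Schanuel.Schanuel.Theses.DiophantineDichotomy (KhovanskiiApproxType)
open Summit.Schanuel.Schanuel.Cruxes.KhovanskiiApproxType.LwSmallHeight

/-- The crux's challenger clauses at level `(d, H)` for a tuple `γ : ι → ℂ`: common field degree `≤ d`,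
every coordinate a root of a non-zero integer polynomial of degree `≤ d` and naive height `≤ H`. -/
def IsChallenger {ι : Type} (γ : ι → ℂ) (d H : ℕ) : Prop :=
  Module.finrank ℚ ↥(IntermediateField.adjoin ℚ (Set.range γ)) ≤ d ∧
    ∀ i, ∃ P : Polynomial ℤ, P ≠ 0 ∧ P.natDegree ≤ d ∧ (∀ k, |P.coeff k| ≤ (H : ℤ)) ∧
      Polynomial.aeval (γ i) P = 0

/-- **GraphMeasure** `n R a b C` — the θ-FREE statement (card `graph-uniform-lw`, Transfer `C⁺`):
a simultaneous Hermite–Lindemann / Lindemann–Weierstrass measure on the graph of `exp` in `ℂⁿ × ℂⁿ`,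
UNIFORM over all algebraic frequency vectors. For every algebraic challenger `γ = (β, α)` at level
`(d, H)` whose frequency part `β` is `ℚ`-linearly independent with `‖β_j‖ ≤ R`:
`max_j |exp(β_j) − α_j| ≥ exp(−C(dᵃ log H + dᵇ))`. `exp` is evaluated at ALGEBRAIC points only.
Expected truth: `a = 1/n` (heuristic count; proved in the function-field model with `b = 1`). -/
def GraphMeasure (n : ℕ) (R a b C : ℝ) : Prop :=
  0 < C ∧ ∀ (d H : ℕ) (γ : Fin n ⊕ Fin n → ℂ),
    LinearIndependent ℚ (γ ∘ Sum.inl) → (∀ j, ‖γ (Sum.inl j)‖ ≤ R) → IsChallenger γ d H →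
    Real.exp (-(C * ((d : ℝ) ^ a * Real.log H + (d : ℝ) ^ b))) ≤
      ‖fun j : Fin n => Complex.exp (γ (Sum.inl j)) - γ (Sum.inr j)‖

/-- **PolyLinIndep** `n s κ c` — polynomial linear-independence measure of `s ∈ ℂⁿ` (Baker type):
`‖q‖^κ · |q₁s₁ + ⋯ + qₙsₙ| ≥ c > 0` for every non-zero `q ∈ ℤⁿ`. Known at explicit free Khovanskii
points (Lindemann–Weierstrass points by Liouville, log-points by Baker, `(1, iπ)` trivially); it is
the bounded-degree layer of the crux at implicit points (open there, as for every line). -/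
def PolyLinIndep (n : ℕ) (s : Fin n → ℂ) (κ c : ℝ) : Prop :=
  0 < c ∧ ∀ q : Fin n → ℤ, q ≠ 0 → c ≤ ‖q‖ ^ κ * ‖∑ j, (q j : ℂ) * s j‖

/-- **SmallRelation** `n` — bookkeeping (provable now, pure algebra of `ℚ̄`): `ℚ`-linearly DEPENDENT
algebraic numbers `β₁, …, βₙ` at level `(d, H)` satisfy a non-zero integer relation with
`max |q_j| ≤ (n(d+1)H)^{3n²}` (Cramer on an `m × m` minor of the conjugate matrix `(σᵢ βⱼ)`, heights of
determinants, clearing denominators). -/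
def SmallRelation (n : ℕ) : Prop :=
  ∀ (d H : ℕ) (β : Fin n → ℂ), IsChallenger β d H → ¬ LinearIndependent ℚ β →
    ∃ q : Fin n → ℤ, q ≠ 0 ∧ ∑ j, (q j : ℂ) * β j = 0 ∧ ∀ j, |q j| ≤ ((n * (d + 1) * H) ^ (3 * n ^ 2) : ℕ)

set_option maxHeartbeats 1600000 in
/-- **Transfer lemma (first lemma of `graph-uniform-lw`; PROVED):** at ANY point `s ∈ ℂⁿ`
(Khovanskii or not), a graph measure with exponent `0 ≤ a`, a polynomial linear-independence measure
of `s` and the relation bookkeeping give the crux's approximation type `(a, max b 1, C')` at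
`θ = (s, e^s)`. Independent-frequency challengers: `|e^{β_j} − α_j| ≤ (2e^R + 1)‖γ − θ‖`
(`Complex.norm_exp_sub_one_le`); dependent ones: `‖γ − θ‖ ≥ ‖β − s‖ ≥ |⟨q, s⟩|/(n‖q‖) ≥ c/(n‖q‖^{κ+1})`. -/
theorem approxTypeAt_of_graphMeasure (n : ℕ) (s : Fin n → ℂ) (R a b C κ c : ℝ)
    (ha : 0 ≤ a) (hκ : 0 ≤ κ) (hR : ∀ i, ‖s i‖ + 1 ≤ R)
    (hG : GraphMeasure n R a b C) (hP : PolyLinIndep n s κ c) (hSR : SmallRelation n) :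
    ∃ C' : ℝ, ApproxTypeAt n s a (max b 1) C' := by
  obtain ⟨hC, hG⟩ := hG
  obtain ⟨hc, hP⟩ := hP
  -- the two correction constants: `A` for independent challengers, `B` for dependent ones
  set A : ℝ := Real.log (2 * Real.exp R + 1) with hA
  set B : ℝ := 3 * (n : ℝ) ^ 2 * (κ + 1) * ((n : ℝ) + 2) + n + |Real.log c| + 1 with hB
  have hB0 : 0 ≤ B := by rw [hB]; positivity
  refine ⟨C + |A| + B, by positivity, ?_⟩
  intro d H γ hfr hcl
  set θ : Fin n ⊕ Fin n → ℂ := Sum.elim s (Complex.exp ∘ s) with hθ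
  -- degenerate dimension `n = 0`: the graph measure is then contradictory
  rcases Nat.eq_zero_or_pos n with hn0 | hnpos
  · exfalso
    subst hn0
    have h := hG d H γ linearIndependent_empty_type (fun j => j.elim0) ⟨hfr, hcl⟩
    have h0 : ‖fun j : Fin 0 => Complex.exp (γ (Sum.inl j)) - γ (Sum.inr j)‖ = 0 := by
      rw [norm_eq_zero]; exact Subsingleton.elim _ _
    rw [h0] at h
    exact absurd h (not_le.mpr (Real.exp_pos _))
  have hn1 : 1 ≤ n := hnpos
  -- `d ≥ 1`, `H ≥ 1` from the clause at one coordinate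
  obtain ⟨P0, hP0ne, hP0deg, hP0coef, hP0root⟩ := hcl (Sum.inl ⟨0, hn1⟩)
  have hdP : 1 ≤ P0.natDegree := by
    rw [Nat.one_le_iff_ne_zero]
    intro h0
    have hcst : P0 = Polynomial.C (P0.coeff 0) := Polynomial.eq_C_of_natDegree_eq_zero h0
    rw [hcst, Polynomial.aeval_C, algebraMap_int_eq, eq_intCast, Int.cast_eq_zero] at hP0root
    exact hP0ne (by rw [hcst, hP0root, map_zero])
  have hd1 : 1 ≤ d := hdP.trans hP0deg
  have hH1 : 1 ≤ H := by
    have h1 : 1 ≤ |P0.leadingCoeff| := Int.one_le_abs (Polynomial.leadingCoeff_ne_zero.mpr hP0ne)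
    have h2 : |P0.leadingCoeff| ≤ (H : ℤ) := by rw [← Polynomial.coeff_natDegree]; exact hP0coef _
    exact_mod_cast h1.trans h2
  have hd1r : (1 : ℝ) ≤ d := by exact_mod_cast hd1
  have hH1r : (1 : ℝ) ≤ H := by exact_mod_cast hH1
  have hdpos : (0 : ℝ) < d := by linarith
  have hlogH : 0 ≤ Real.log H := Real.log_nonneg hH1r
  have hda : 1 ≤ (d : ℝ) ^ a := Real.one_le_rpow hd1r ha
  have hdb : (d : ℝ) ^ b ≤ (d : ℝ) ^ (max b 1) := Real.rpow_le_rpow_of_exponent_le hd1r (le_max_left _ _)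
  have hd1b : (d : ℝ) ≤ (d : ℝ) ^ (max b 1) := by
    have h := Real.rpow_le_rpow_of_exponent_le hd1r (le_max_right b 1)
    rwa [Real.rpow_one] at h
  set S0 : ℝ := (d : ℝ) ^ a * Real.log H + (d : ℝ) ^ b with hS0
  set S : ℝ := (d : ℝ) ^ a * Real.log H + (d : ℝ) ^ (max b 1) with hS
  have hdalog : 0 ≤ (d : ℝ) ^ a * Real.log H := mul_nonneg (by linarith) hlogH
  have hS1 : 1 ≤ S := by rw [hS]; linarith
  have hS0S : S0 ≤ S := by rw [hS0, hS]; linarith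
  have hSnn : 0 ≤ S := by linarith
  -- the target exponent
  show Real.exp (-((C + |A| + B) * S)) ≤ ‖γ - θ‖
  have hEnn : 0 ≤ (C + |A| + B) * S := mul_nonneg (by positivity) hSnn
  -- far challengers are trivial
  by_cases hfar : 1 < ‖γ - θ‖
  · calc Real.exp (-((C + |A| + B) * S)) ≤ 1 := Real.exp_le_one_iff.mpr (by linarith)
      _ ≤ ‖γ - θ‖ := hfar.le
  have hnear : ‖γ - θ‖ ≤ 1 := not_lt.mp hfar
  -- components
  have hcompz : ∀ j, ‖γ (Sum.inl j) - s j‖ ≤ ‖γ - θ‖ := fun j => by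
    have h := norm_le_pi_norm (γ - θ) (Sum.inl j)
    simpa [hθ] using h
  have hcompy : ∀ j, ‖γ (Sum.inr j) - Complex.exp (s j)‖ ≤ ‖γ - θ‖ := fun j => by
    have h := norm_le_pi_norm (γ - θ) (Sum.inr j)
    simpa [hθ] using h
  by_cases hli : LinearIndependent ℚ (γ ∘ Sum.inl)
  · -- INDEPENDENT frequencies: the graph measure at the challenger's own frequencies
    have hβR : ∀ j, ‖γ (Sum.inl j)‖ ≤ R := fun j => by
      have h1 : ‖γ (Sum.inl j)‖ ≤ ‖γ (Sum.inl j) - s j‖ + ‖s j‖ := norm_le_norm_sub_add _ _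
      linarith [hcompz j, hR j]
    have key := hG d H γ hli hβR ⟨hfr, hcl⟩
    have hK : 0 < 2 * Real.exp R + 1 := by positivity
    have hF : ‖fun j : Fin n => Complex.exp (γ (Sum.inl j)) - γ (Sum.inr j)‖ ≤
        (2 * Real.exp R + 1) * ‖γ - θ‖ := by
      refine (pi_norm_le_iff_of_nonneg (by positivity)).mpr fun j => ?_
      have e1 : ‖Complex.exp (γ (Sum.inl j)) - Complex.exp (s j)‖ ≤ 2 * Real.exp R * ‖γ - θ‖ := by
        have hfac : Complex.exp (γ (Sum.inl j)) - Complex.exp (s j) =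
            Complex.exp (s j) * (Complex.exp (γ (Sum.inl j) - s j) - 1) := by
          rw [mul_sub, mul_one, ← Complex.exp_add, add_sub_cancel]
        rw [hfac, norm_mul, Complex.norm_exp]
        have hre : (s j).re ≤ R := by
          have := Complex.abs_re_le_norm (s j)
          linarith [le_abs_self (s j).re, hR j]
        have hsmall : ‖γ (Sum.inl j) - s j‖ ≤ 1 := (hcompz j).trans hnear
        have h2 := Complex.norm_exp_sub_one_le hsmall
        calc Real.exp (s j).re * ‖Complex.exp (γ (Sum.inl j) - s j) - 1‖
            ≤ Real.exp R * (2 * ‖γ (Sum.inl j) - s j‖) := by gcongr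
          _ ≤ Real.exp R * (2 * ‖γ - θ‖) := by gcongr; exact hcompz j
          _ = 2 * Real.exp R * ‖γ - θ‖ := by ring
      have e2 : ‖Complex.exp (s j) - γ (Sum.inr j)‖ ≤ ‖γ - θ‖ := by
        rw [norm_sub_rev]; exact hcompy j
      calc ‖Complex.exp (γ (Sum.inl j)) - γ (Sum.inr j)‖
          ≤ ‖Complex.exp (γ (Sum.inl j)) - Complex.exp (s j)‖ + ‖Complex.exp (s j) - γ (Sum.inr j)‖ :=
            norm_sub_le_norm_sub_add_norm_sub _ _ _
        _ ≤ 2 * Real.exp R * ‖γ - θ‖ + ‖γ - θ‖ := add_le_add e1 e2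
        _ = (2 * Real.exp R + 1) * ‖γ - θ‖ := by ring
    have hA' : Real.exp (-A) * (2 * Real.exp R + 1) = 1 := by
      rw [hA, Real.exp_neg, Real.exp_log hK, inv_mul_cancel₀ hK.ne']
    have hE1 : C * S0 + A ≤ (C + |A| + B) * S := by
      have h1 : C * S0 ≤ C * S := mul_le_mul_of_nonneg_left hS0S hC.le
      have h2 : A ≤ |A| * S := (le_abs_self A).trans (le_mul_of_one_le_right (abs_nonneg A) hS1)
      have h3 : 0 ≤ B * S := mul_nonneg hB0 hSnn
      nlinarith
    calc Real.exp (-((C + |A| + B) * S)) ≤ Real.exp (-(C * S0 + A)) := Real.exp_le_exp.mpr (by linarith)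
      _ = Real.exp (-(C * S0)) * Real.exp (-A) := by rw [neg_add, Real.exp_add]
      _ ≤ ((2 * Real.exp R + 1) * ‖γ - θ‖) * Real.exp (-A) := by
          gcongr
          exact key.trans hF
      _ = ‖γ - θ‖ * (Real.exp (-A) * (2 * Real.exp R + 1)) := by ring
      _ = ‖γ - θ‖ := by rw [hA', mul_one]
  · -- DEPENDENT frequencies: small integer relation + linear-independence measure of `s`
    have hfin : FiniteDimensional ℚ ↥(IntermediateField.adjoin ℚ (Set.range γ)) := by
      refine IntermediateField.finiteDimensional_adjoin fun x hx => ?_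
      obtain ⟨i, rfl⟩ := hx
      obtain ⟨P, hP0, -, -, hroot⟩ := hcl i
      refine (show IsAlgebraic ℚ (γ i) from ⟨P.map (Int.castRingHom ℚ), ?_, ?_⟩).isIntegral
      · exact (Polynomial.map_ne_zero_iff (Int.castRingHom ℚ).injective_int).mpr hP0
      · rw [← algebraMap_int_eq, Polynomial.aeval_map_algebraMap]; exact hroot
    have hle : IntermediateField.adjoin ℚ (Set.range (γ ∘ Sum.inl)) ≤
        IntermediateField.adjoin ℚ (Set.range γ) :=
      IntermediateField.adjoin.mono _ _ _ (Set.range_comp_subset_range _ _)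
    have hfrβ : Module.finrank ℚ ↥(IntermediateField.adjoin ℚ (Set.range (γ ∘ Sum.inl))) ≤ d :=
      (IntermediateField.finrank_le_of_le_right hle).trans hfr
    obtain ⟨q, hq0, hqrel, hqb⟩ := hSR d H (γ ∘ Sum.inl) ⟨hfrβ, fun j => hcl (Sum.inl j)⟩ hli
    -- the relation transported to `s`
    have hsum : ∑ j, (q j : ℂ) * s j = ∑ j, (q j : ℂ) * (s j - γ (Sum.inl j)) := by
      have h0 : ∑ j, (q j : ℂ) * γ (Sum.inl j) = 0 := by simpa using hqrel
      simp only [mul_sub, Finset.sum_sub_distrib, h0, sub_zero]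
    have hnormsum : ‖∑ j, (q j : ℂ) * s j‖ ≤ n * ‖q‖ * ‖γ - θ‖ := by
      rw [hsum]
      calc ‖∑ j, (q j : ℂ) * (s j - γ (Sum.inl j))‖
          ≤ ∑ j, ‖(q j : ℂ) * (s j - γ (Sum.inl j))‖ := norm_sum_le _ _
        _ ≤ ∑ _j : Fin n, ‖q‖ * ‖γ - θ‖ := Finset.sum_le_sum fun j _ => by
            rw [norm_mul]
            have h1 : ‖(q j : ℂ)‖ ≤ ‖q‖ := by
              have e : ‖(q j : ℂ)‖ = ‖q j‖ := by rw [Complex.norm_intCast, Int.norm_eq_abs]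
              rw [e]; exact norm_le_pi_norm q j
            have h2 : ‖s j - γ (Sum.inl j)‖ ≤ ‖γ - θ‖ := by rw [norm_sub_rev]; exact hcompz j
            exact mul_le_mul h1 h2 (norm_nonneg _) (norm_nonneg _)
        _ = n * ‖q‖ * ‖γ - θ‖ := by
            simp only [Finset.sum_const, Finset.card_univ, Fintype.card_fin, nsmul_eq_mul]; ring
    -- size of the relation
    set Bn : ℕ := (n * (d + 1) * H) ^ (3 * n ^ 2) with hBn
    have hbase1 : 1 ≤ n * (d + 1) * H := Nat.one_le_iff_ne_zero.mpr (by positivity)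
    have hBn1 : (1 : ℝ) ≤ Bn := by exact_mod_cast Nat.one_le_pow _ _ hbase1
    have hBnpos : (0 : ℝ) < Bn := by linarith
    have hqnorm : ‖q‖ ≤ (Bn : ℝ) := by
      refine (pi_norm_le_iff_of_nonneg hBnpos.le).mpr fun j => ?_
      rw [Int.norm_eq_abs]
      have h := hqb j
      exact_mod_cast h
    have key := hP q hq0
    have hqκ : ‖q‖ ^ κ ≤ (Bn : ℝ) ^ κ := Real.rpow_le_rpow (norm_nonneg _) hqnorm hκ
    set M : ℝ := n * (Bn : ℝ) ^ (κ + 1) with hM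
    have hMpos : 0 < M := by positivity
    have h3 : c ≤ M * ‖γ - θ‖ := by
      have hBκ0 : 0 ≤ (Bn : ℝ) ^ κ := Real.rpow_nonneg hBnpos.le κ
      calc c ≤ ‖q‖ ^ κ * ‖∑ j, (q j : ℂ) * s j‖ := key
        _ ≤ (Bn : ℝ) ^ κ * (n * (Bn : ℝ) * ‖γ - θ‖) := by
            refine mul_le_mul hqκ (hnormsum.trans ?_) (norm_nonneg _) hBκ0
            gcongr
        _ = M * ‖γ - θ‖ := by
            rw [hM, Real.rpow_add_one hBnpos.ne']; ring
    -- `log (M / c) ≤ B * S ≤ E'`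
    have hlogBn : Real.log (Bn : ℝ) = (3 * n ^ 2 : ℕ) * (Real.log n + Real.log ((d : ℝ) + 1) + Real.log H) := by
      have e : (Bn : ℝ) = ((n : ℝ) * ((d : ℝ) + 1) * H) ^ (3 * n ^ 2) := by rw [hBn]; push_cast; ring
      have hn0 : (n : ℝ) ≠ 0 := by exact_mod_cast (show n ≠ 0 by omega)
      have hd0 : (d : ℝ) + 1 ≠ 0 := by linarith
      have hH0 : (H : ℝ) ≠ 0 := by linarith
      rw [e, Real.log_pow, Real.log_mul (mul_ne_zero hn0 hd0) hH0, Real.log_mul hn0 hd0]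
    have hlogn : Real.log n ≤ n * S := by
      have h1 : Real.log (n : ℝ) ≤ n := (Real.log_le_sub_one_of_pos (by exact_mod_cast hnpos)).trans (by linarith)
      have hn0 : (0 : ℝ) ≤ n := by exact_mod_cast hnpos.le
      nlinarith
    have hlogd : Real.log ((d : ℝ) + 1) ≤ S := by
      have h1 : Real.log ((d : ℝ) + 1) ≤ (d : ℝ) + 1 - 1 := Real.log_le_sub_one_of_pos (by linarith)
      rw [hS]; linarith
    have hlogHS : Real.log H ≤ S := by
      have h1 : Real.log H ≤ (d : ℝ) ^ a * Real.log H := le_mul_of_one_le_left hlogH hda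
      rw [hS]; linarith [Real.rpow_nonneg hdpos.le (max b 1)]
    have hlogsum : Real.log n + Real.log ((d : ℝ) + 1) + Real.log H ≤ ((n : ℝ) + 2) * S := by
      linarith [hlogn, hlogd, hlogHS]
    have hlogM : Real.log (M / c) ≤ B * S := by
      rw [Real.log_div hMpos.ne' hc.ne', hM, Real.log_mul (by exact_mod_cast (show n ≠ 0 by omega))
        (by positivity), Real.log_rpow hBnpos, hlogBn]
      have hκ1 : 0 ≤ κ + 1 := by linarith only [hκ]
      have h32 : (0 : ℝ) ≤ ((3 * n ^ 2 : ℕ) : ℝ) := by positivity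
      have hprod : (κ + 1) * (((3 * n ^ 2 : ℕ) : ℝ) * (Real.log n + Real.log ((d : ℝ) + 1) + Real.log H))
          ≤ (κ + 1) * (((3 * n ^ 2 : ℕ) : ℝ) * (((n : ℝ) + 2) * S)) :=
        mul_le_mul_of_nonneg_left (mul_le_mul_of_nonneg_left hlogsum h32) hκ1
      have hc' : -Real.log c ≤ |Real.log c| * S :=
        (neg_le_abs _).trans (le_mul_of_one_le_right (abs_nonneg _) hS1)
      have hcast : ((3 * n ^ 2 : ℕ) : ℝ) = 3 * (n : ℝ) ^ 2 := by push_cast; ring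
      rw [hcast] at hprod
      rw [hcast, hB]
      linarith only [hlogn, hprod, hc', hS1, hSnn]
    have hE2 : Real.log (M / c) ≤ (C + |A| + B) * S := by
      have h1 : 0 ≤ C * S := mul_nonneg hC.le hSnn
      have h2 : 0 ≤ |A| * S := mul_nonneg (abs_nonneg _) hSnn
      linarith only [hlogM, h1, h2]
    calc Real.exp (-((C + |A| + B) * S)) ≤ Real.exp (-Real.log (M / c)) :=
          Real.exp_le_exp.mpr (neg_le_neg hE2)
      _ = c / M := by rw [Real.exp_neg, Real.exp_log (div_pos hMpos hc), inv_div]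
      _ ≤ ‖γ - θ‖ := by rw [div_le_iff₀ hMpos]; linarith only [h3]

/-- **Composition by name (bookkeeping):** graph measures with `0 ≤ a < 1/(n−1)` for all `n ≥ 2` and all
radii, polynomial linear-independence measures at free Khovanskii points, and the relation bookkeeping
give the crux `KhovanskiiApproxType` (via `khovanskiiApproxType_iff`, `Iff.rfl`). -/
theorem khovanskiiApproxType_of_graphMeasure
    (hG : ∀ n : ℕ, 2 ≤ n → ∀ R : ℝ, ∃ a b C : ℝ, 0 ≤ a ∧ a < 1 / ((n : ℝ) - 1) ∧ GraphMeasure n R a b C)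
    (hP : ∀ (n : ℕ) (s : Fin n → ℂ), 2 ≤ n → LinearIndependent ℚ s → IsFreeKhovanskii n s →
      ∃ κ c : ℝ, 0 ≤ κ ∧ PolyLinIndep n s κ c)
    (hSR : ∀ n, SmallRelation n) : KhovanskiiApproxType := by
  rw [khovanskiiApproxType_iff]
  intro n s hn hli hK
  obtain ⟨κ, c, hκ, hPs⟩ := hP n s hn hli hK
  set R : ℝ := (Finset.univ.sup' (Finset.univ_nonempty_iff.mpr ⟨⟨0, by omega⟩⟩) fun i => ‖s i‖) + 1
    with hRdef
  have hR : ∀ i, ‖s i‖ + 1 ≤ R := fun i => by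
    have : ‖s i‖ ≤ Finset.univ.sup' (Finset.univ_nonempty_iff.mpr ⟨⟨0, by omega⟩⟩) fun i => ‖s i‖ :=
      Finset.le_sup' (fun i => ‖s i‖) (Finset.mem_univ i)
    linarith
  obtain ⟨a, b, C, ha, halt, hGn⟩ := hG n hn R
  obtain ⟨C', hAT⟩ := approxTypeAt_of_graphMeasure n s R a b C κ c ha hκ hR hGn hPs (hSR n)
  exact ⟨a, max b 1, C', halt, hAT⟩

/-! ## Card `roy-transport`: Roy's auxiliary polynomials at the challenger's subgroup

Vocabulary aligned with `Literature/NumberTheory/Transcendental/RoyCriterion.lean` (`royD`, `mvPolyHeight`,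
`RoyAdmissible`, `RoyHypothesis`); the unconditional existence of Roy-small polynomials at the TRUE
configuration `(y, e^y)` — even `exp(−2N^u)`-small on the whole disc `‖z‖ ≤ 1 + c N^{s₁}` — is the tree's
`Literature.NumberTheory.Transcendental.exists_royAuxPoly` / `royHypothesis_exp'` (RoyCriterionProofs,
sorry-free; not imported here to keep the sketch light). -/

open Literature.NumberTheory.Transcendental (royD mvPolyHeight RoyAdmissible)

/-- Roy's box at scale `N`: `P ≠ 0`, `deg_{X₀} P ≤ N^{t₀}`, `deg_{X₁} P ≤ N^{t₁}`, height `≤ e^N`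
(shape of `RoyHypothesis`). -/
def RoyBox (P : MvPolynomial (Fin 2) ℤ) (N : ℕ) (t₀ t₁ : ℝ) : Prop :=
  P ≠ 0 ∧ (P.degreeOf 0 : ℝ) ≤ (N : ℝ) ^ t₀ ∧ (P.degreeOf 1 : ℝ) ≤ (N : ℝ) ^ t₁ ∧
    (mvPolyHeight P : ℝ) ≤ Real.exp N

/-- Roy-small values with multiplicity along `D = ∂₀ + X₁∂₁` on the box of the subgroup of `ℂ × ℂˣ`
generated by the pairs `(y_j, w_j)`: `|D^k P(∑ m_j y_j, ∏ w_j^{m_j})| ≤ exp(−N^u)`, `k ≤ N^{s₀}`,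
`max m_j ≤ N^{s₁}` (shape of `RoyHypothesis`, with `w` in place of `α`). -/
def RoySmallOn (n : ℕ) (y w : Fin n → ℂ) (P : MvPolynomial (Fin 2) ℤ) (N : ℕ) (s₀ s₁ u : ℝ) : Prop :=
  ∀ (k : ℕ) (m : Fin n → ℕ), (k : ℝ) ≤ (N : ℝ) ^ s₀ → (∀ j, (m j : ℝ) ≤ (N : ℝ) ^ s₁) →
    ‖MvPolynomial.aeval ![∑ j, (m j : ℂ) * y j, ∏ j, w j ^ m j] (royD^[k] P)‖ ≤ Real.exp (-(N : ℝ) ^ u)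

/-- **AlgSmallValueProhibition** `n R s₀ s₁ t₀ t₁ u a b C` (card `roy-transport`, Transfer `C⁺`):
at ALGEBRAIC configurations — challengers `γ = (β, α)` at level `(d, H)` with `ℚ`-linearly independent
`β`, `‖β_j‖ ≤ R` — no polynomial in Roy's box is Roy-small on the subgroup generated by the pairs
`(β_j, α_j)` at any scale `N` with `N^u ≥ C(dᵃ log H + dᵇ)`. In the range
`N^{u−s₁−t₁} ≫ d·max h(β_j, α_j)` this is Liouville + a zero estimate on `𝔾ₐ × 𝔾ₘ` (the obstruction
subgroups `{0} × 𝔾ₘ`, `𝔾ₐ × {1}` are excluded by `LinearIndependent ℚ β` and `t₁ < s₁`, `t₀ < s₀`); the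
content is the height-dominated range below it (effective "moreover: exact vanishing" clause of Roy-type
small value estimates at algebraic points). -/
def AlgSmallValueProhibition (n : ℕ) (R s₀ s₁ t₀ t₁ u a b C : ℝ) : Prop :=
  0 < C ∧ ∀ (d H N : ℕ) (γ : Fin n ⊕ Fin n → ℂ) (P : MvPolynomial (Fin 2) ℤ),
    LinearIndependent ℚ (γ ∘ Sum.inl) → (∀ j, ‖γ (Sum.inl j)‖ ≤ R) → IsChallenger γ d H →
    C * ((d : ℝ) ^ a * Real.log H + (d : ℝ) ^ b) ≤ (N : ℝ) ^ u → RoyBox P N t₀ t₁ →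
    ¬ RoySmallOn n (γ ∘ Sum.inl) (γ ∘ Sum.inr) P N s₀ s₁ u

/-- **First lemma of `roy-transport` (provable now from the tree's `exists_royAuxPoly` + analysis):
TRANSPORT.** A Roy-box polynomial which is `exp(−2N^u)`-small as a function `P(z, e^z)` on the disc
`‖z‖ ≤ 1 + nR·N^{s₁}` (this is what `exists_royAuxPoly` supplies, with all `D`-derivatives, since
`D^k P(z, e^z) = (d/dz)^k [P(z, e^z)]`) is `exp(−N^u)`-small on the subgroup of ANY configuration `(β, w)`
with `‖β_j‖ ≤ R` whose GRAPH DEFECT `max_j |e^{β_j} − w_j|` is `≤ exp(−3N^u)`, for `N ≥ N₁(n, R, exponents)`: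
`|D^k P(∑ m_jβ_j, ∏ w_j^{m_j}) − D^k P(∑ m_jβ_j, e^{∑ m_jβ_j})| ≤ exp(N + c N^{s₁+t₁} + c N^{t₀} log N)·defect`.
Hence prohibition ⇒ graph measure: -/
theorem graphMeasure_of_prohibition (n : ℕ) (R s₀ s₁ t₀ t₁ u a b C : ℝ)
    (hadm : RoyAdmissible s₀ s₁ t₀ t₁ u) (ha : 0 ≤ a) (hR : 0 ≤ R)
    (h : AlgSmallValueProhibition n R s₀ s₁ t₀ t₁ u a b C) :
    ∃ C' : ℝ, GraphMeasure n R a (max b 1) C' := by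
  sorry

/-- **Composition of `roy-transport` into the crux BY NAME (proved modulo the transport stub):**
prohibitions for every `n ≥ 2` and radius (with exponent `a < 1/(n−1)`), polynomial linear-independence
measures at free Khovanskii points and the relation bookkeeping give `KhovanskiiApproxType`. -/
theorem khovanskiiApproxType_of_prohibition (s₀ s₁ t₀ t₁ u : ℝ) (hadm : RoyAdmissible s₀ s₁ t₀ t₁ u)
    (hASV : ∀ n : ℕ, 2 ≤ n → ∀ R : ℝ, 0 ≤ R →
      ∃ a b C : ℝ, 0 ≤ a ∧ a < 1 / ((n : ℝ) - 1) ∧ AlgSmallValueProhibition n R s₀ s₁ t₀ t₁ u a b C)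
    (hP : ∀ (n : ℕ) (s : Fin n → ℂ), 2 ≤ n → LinearIndependent ℚ s → IsFreeKhovanskii n s →
      ∃ κ c : ℝ, 0 ≤ κ ∧ PolyLinIndep n s κ c)
    (hSR : ∀ n, SmallRelation n) : KhovanskiiApproxType := by
  refine khovanskiiApproxType_of_graphMeasure (fun n hn R => ?_) hP hSR
  -- the graph measure at radius `max R 0` restricts to radius `R`
  obtain ⟨a, b, C, ha, halt, hA⟩ := hASV n hn (max R 0) (le_max_right _ _)
  obtain ⟨C', hG⟩ := graphMeasure_of_prohibition n (max R 0) s₀ s₁ t₀ t₁ u a b C hadm ha (le_max_right _ _) hA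
  refine ⟨a, max b 1, C', ha, halt, hG.1, fun d H γ hli hβ hγ => hG.2 d H γ hli (fun j => (hβ j).trans (le_max_left _ _)) hγ⟩

end Summit.Schanuel.Schanuel.Cruxes.KhovanskiiApproxType.Ideate3g2
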